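import Mathlib
import Literature.Computability.AlgebraicComplexity.PlethysmStability
import Literature.Computability.AlgebraicComplexity.GCTObstructions
import HarnessLib

/-!
# Twist positivity, I: the word-model Hermitian form on `ℂ[Sym^n]_d` — positivity, adjointness, and
# diagonal rescalings (crux `ValuativeGCT.ValuativeFlip`, stmt-ValiantsHypothesis-12624; wall-breaker k12 gen 1,
# axis "representation-stability transfer between `m` and `m + 1`"; helper file `--supports`)

The INHERITANCE HALF OF BLMW 2011 PROBLEM 6.10 (`mult_{λ+(sδ)} ℂ[Δ(x^s g)] ≥ mult_λ ℂ[Δ(g)]` for every inner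
form `g` and every padding `s`) is proved in this three-file series by a POSITIVITY argument ("the unitary
trick"): a positive-definite rescaling of the (G-stable) ideal of an orbit closure cannot contain more
highest-weight vectors than the ideal itself.  This first file supplies the Hermitian structure, transported from
the word model `Sym^d Sym^n V ⊆ ⊗^{dn} V` of the tree (`wordOfForm`, `wordOfForm_coordSubst`, BIP §4 (4.1)):
* the form `⟨F, G⟩ = ∑_w conj(Φ F w) · Φ G w` (`Φ = wordOfForm ρ n d`), positive definite on forms of degree `d`
  (injectivity of the polarisation, `eq_of_wordOfForm_eq`);
* a diagonal rescaling `tw = aeval (e ↦ a_e X_e)` by positive integers acts diagonally on the word model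
  (`tp_wordOfForm_twist`: `Φ(tw F)(w) = τ(w) Φ(F)(w)`, `τ(w) > 0`), hence `⟨tw F, F⟩ = 0 ⇒ F = 0`
  (`tp_eq_zero_of_form_twist_eq_zero`) — the registered stub of this file is the coefficient formula
  `tp_coeff_twist`;
* ADJOINTNESS of the `GL`-action: `⟨b·F, G⟩ = ⟨F, b^♯·G⟩` with `b^♯ ∈ GL` built from the conjugate transpose
  (`tp_form_adjoint`; the Kronecker power of `g^H` is the conjugate transpose of that of `g`).

Sources: BLMW, SIAM J. Comput. 40 (2011) §6.4 Problem 6.10; Bürgisser–Ikenmeyer–Panova, J. AMS 32 (2019) §4 (4.1);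
Weyl's unitary trick (Fulton–Harris §9.3); this seat's `Cruxes/ValuativeFlip/TwistPositivityK12G1.md`.
-/

set_option linter.dupNamespace false

namespace Summit.ValiantsHypothesis.ValiantsHypothesis.Theorems.ValuativeFlip

open scoped BigOperators Matrix ComplexConjugate
open MvPolynomial
open Literature.NumberTheory.DiophantineGeometry
open Literature.Computability.AlgebraicComplexity

noncomputable section

variable {σ : Type*} [Fintype σ] [LinearOrder σ] {M n d : ℕ}

/-- The coefficients of a diagonally rescaled polynomial: if `tw = aeval (e ↦ t_e X_e)` then
`coeff_s (tw F) = (∏_e t_e^{s_e}) · coeff_s F`. [folklore] -/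
theorem tp_coeff_twist {ι : Type*} (t : ι → ℂ) (F : MvPolynomial ι ℂ) (s : ι →₀ ℕ) :
    coeff s (aeval (fun e => C (t e) * X e) F) = (s.prod fun e k => t e ^ k) * coeff s F := by
  classical
  induction F using MvPolynomial.induction_on' with
  | monomial u a =>
    rw [aeval_monomial, coeff_monomial]
    have hprod : (u.prod fun e k => (C (t e) * X e : MvPolynomial ι ℂ) ^ k) =
        C (u.prod fun e k => t e ^ k) * monomial u 1 := by
      rw [Finsupp.prod, Finsupp.prod, map_prod, monomial_eq, C_1, one_mul, Finsupp.prod,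
        ← Finset.prod_mul_distrib]
      refine Finset.prod_congr rfl fun e _ => ?_
      rw [mul_pow, map_pow]
    rw [hprod, Algebra.algebraMap_eq_smul_one, smul_mul_assoc, one_mul, coeff_smul, coeff_C_mul,
      coeff_monomial, smul_eq_mul]
    split_ifs with h
    · subst h; ring
    · ring
  | add p q hp hq => rw [map_add, coeff_add, coeff_add, hp, hq, mul_add]

/-- `wordOfForm` is additive. [folklore] -/
theorem tp_wordOfForm_add (ρ : Fin M ≃ σ) (F G : MvPolynomial (DegIdx σ n) ℂ) :
    wordOfForm ρ n d (F + G) = wordOfForm ρ n d F + wordOfForm ρ n d G := by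
  funext w
  rw [Pi.add_apply, wordOfForm_apply, wordOfForm_apply, wordOfForm_apply, ← polarizeLin_apply,
    ← polarizeLin_apply, ← polarizeLin_apply, map_add, Pi.add_apply]

/-- `wordOfForm 0 = 0`. [folklore] -/
theorem tp_wordOfForm_zero (ρ : Fin M ≃ σ) : wordOfForm ρ n d (0 : MvPolynomial (DegIdx σ n) ℂ) = 0 := by
  funext w
  rw [wordOfForm_apply, ← polarizeLin_apply, map_zero]
  rfl

/-- **A diagonal rescaling acts diagonally on the word model**: `Φ(tw F)(w) = τ(w) · Φ(F)(w)` with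
`τ(w) = ∏_e t_e^{s(w)_e}`, `s(w)` the exponent pattern of the contents of the blocks of `w`. [folklore] -/
theorem tp_wordOfForm_twist (ρ : Fin M ≃ σ) (t : DegIdx σ n → ℂ) (F : MvPolynomial (DegIdx σ n) ℂ)
    (w : Word M (d * n)) :
    wordOfForm ρ n d (aeval (fun e => C (t e) * X e) F) w =
      ((wordExp fun r : Fin d => (⟨wordExp fun p : Fin n => ρ (w (finProdFinEquiv (r, p))),
          mem_degMonomials_iff.mpr (degree_wordExp _)⟩ : DegIdx σ n)).prod fun e k => t e ^ k) *
        wordOfForm ρ n d F w := by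
  rw [wordOfForm_apply, wordOfForm_apply, polarize, polarize, arrOf, arrOf, tp_coeff_twist, mul_div_assoc]

/-- **Positivity of the word-model form against a positive rescaling.** For `F` a form of degree `d`
and `tw = aeval (e ↦ a_e X_e)` with positive integers `a_e`: if `∑_w conj(Φ(tw F)(w)) Φ(F)(w) = 0`
then `F = 0` (each term is `τ(w) |Φ(F)(w)|²` with `τ(w) > 0`, and `Φ` is injective on forms). [folklore] -/
theorem tp_eq_zero_of_form_twist_eq_zero (ρ : Fin M ≃ σ) (a : DegIdx σ n → ℕ) (ha : ∀ e, 0 < a e)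
    {F : MvPolynomial (DegIdx σ n) ℂ} (hF : F.IsHomogeneous d)
    (h : ∑ w : Word M (d * n), conj (wordOfForm ρ n d (aeval (fun e => C ((a e : ℕ) : ℂ) * X e) F) w) *
      wordOfForm ρ n d F w = 0) : F = 0 := by
  -- the positive weights `c w = ∏_e a_e^{s(w)_e}`
  let s : Word M (d * n) → (DegIdx σ n →₀ ℕ) := fun w =>
    wordExp fun r : Fin d => (⟨wordExp fun p : Fin n => ρ (w (finProdFinEquiv (r, p))),
      mem_degMonomials_iff.mpr (degree_wordExp _)⟩ : DegIdx σ n)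
  let c : Word M (d * n) → ℕ := fun w => (s w).prod fun e k => a e ^ k
  have hc : ∀ w, 0 < c w := fun w => by
    change 0 < (s w).prod fun e k => a e ^ k
    rw [Finsupp.prod]
    exact Finset.prod_pos fun e _ => pow_pos (ha e) _
  have hcast : ∀ w, ((s w).prod fun e k => ((a e : ℕ) : ℂ) ^ k) = ((c w : ℕ) : ℂ) := fun w => by
    change _ = ((((s w).prod fun e k => a e ^ k) : ℕ) : ℂ)
    rw [Finsupp.prod, Finsupp.prod]
    push_cast
    rfl
  -- each term is `c w · |Φ F w|²`
  have hterm : ∀ w : Word M (d * n),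
      conj (wordOfForm ρ n d (aeval (fun e => C ((a e : ℕ) : ℂ) * X e) F) w) * wordOfForm ρ n d F w =
        (((c w : ℝ) * Complex.normSq (wordOfForm ρ n d F w) : ℝ) : ℂ) := by
    intro w
    rw [tp_wordOfForm_twist]
    change conj (((s w).prod fun e k => ((a e : ℕ) : ℂ) ^ k) * wordOfForm ρ n d F w) * wordOfForm ρ n d F w = _
    rw [hcast, map_mul, Complex.conj_natCast, mul_assoc, mul_comm (conj (wordOfForm ρ n d F w)),
      Complex.mul_conj]
    push_cast
    rfl
  have hsum : (((∑ w : Word M (d * n), (c w : ℝ) * Complex.normSq (wordOfForm ρ n d F w) : ℝ)) : ℂ) = 0 := by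
    rw [← h]
    push_cast
    refine Finset.sum_congr rfl fun w _ => ?_
    rw [hterm w]
    push_cast
    rfl
  have hsum' : ∑ w : Word M (d * n), (c w : ℝ) * Complex.normSq (wordOfForm ρ n d F w) = 0 := by
    exact_mod_cast hsum
  have hnonneg : ∀ w ∈ (Finset.univ : Finset (Word M (d * n))),
      0 ≤ (c w : ℝ) * Complex.normSq (wordOfForm ρ n d F w) := fun w _ =>
    mul_nonneg (Nat.cast_nonneg _) (Complex.normSq_nonneg _)
  have hzero := (Finset.sum_eq_zero_iff_of_nonneg hnonneg).mp hsum'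
  have hwz : wordOfForm ρ n d F = 0 := by
    funext w
    have hw := hzero w (Finset.mem_univ w)
    rcases mul_eq_zero.mp hw with h0 | h0
    · exfalso
      exact absurd h0 (by exact_mod_cast (hc w).ne')
    · exact Complex.normSq_eq_zero.mp h0
  exact eq_of_wordOfForm_eq ρ hF (isHomogeneous_zero _ _ d) (by rw [hwz, tp_wordOfForm_zero])

/-- **Adjointness of the action for the word-model form**: `⟨b·F, G⟩ = ⟨F, b^♯·G⟩` where, for
`b = ρ (g⁻¹)ᵀ ρ⁻¹`, `b^♯ = ρ ((g^H)⁻¹)ᵀ ρ⁻¹` with `g^H` the conjugate transpose (the Kronecker power of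
`g^H` is the conjugate transpose of the Kronecker power of `g`). [folklore] -/
theorem tp_form_adjoint (ρ : Fin M ≃ σ) {g g' : GL (Fin M) ℂ}
    (hg' : (g' : Matrix (Fin M) (Fin M) ℂ) = (g : Matrix (Fin M) (Fin M) ℂ)ᴴ)
    {F G : MvPolynomial (DegIdx σ n) ℂ} (hF : F.IsHomogeneous d) (hG : G.IsHomogeneous d) :
    ∑ w : Word M (d * n), conj (wordOfForm ρ n d (coordSubst n (glReindexTransposeInv ρ g) F) w) *
        wordOfForm ρ n d G w =
      ∑ w : Word M (d * n), conj (wordOfForm ρ n d F w) *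
        wordOfForm ρ n d (coordSubst n (glReindexTransposeInv ρ g') G) w := by
  rw [wordOfForm_coordSubst ρ g hF, wordOfForm_coordSubst ρ g' hG]
  simp only [wordRep_apply, map_sum, map_mul, map_prod, Finset.sum_mul, Finset.mul_sum, hg',
    Matrix.conjTranspose_apply, Complex.star_def]
  rw [Finset.sum_comm]
  refine Finset.sum_congr rfl fun a _ => Finset.sum_congr rfl fun b _ => ?_
  ring

/-- The conjugate transpose of an invertible complex matrix, as an element of `GL`. [folklore] -/
theorem tp_exists_conjTranspose (g : GL (Fin M) ℂ) :
    ∃ g' : GL (Fin M) ℂ, (g' : Matrix (Fin M) (Fin M) ℂ) = (g : Matrix (Fin M) (Fin M) ℂ)ᴴ := by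
  have hdet : ((g : Matrix (Fin M) (Fin M) ℂ)ᴴ).det ≠ 0 := by
    rw [Matrix.det_conjTranspose]
    exact star_ne_zero.mpr (Matrix.isUnits_det_units g).ne_zero
  exact ⟨Matrix.GeneralLinearGroup.mkOfDetNeZero _ hdet, by rw [Matrix.GeneralLinearGroup.val_mkOfDetNeZero]⟩

/-- Every `b ∈ GL σ ℂ` is `ρ (g⁻¹)ᵀ ρ⁻¹` for `g = ρ⁻¹ (b⁻¹)ᵀ ρ`. [folklore] -/
theorem tp_exists_glReindexTransposeInv (ρ : Fin M ≃ σ) (b : GL σ ℂ) :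
    ∃ g : GL (Fin M) ℂ, glReindexTransposeInv ρ g = b :=
  ⟨glReindexTransposeInv ρ.symm b, glReindexTransposeInv_glReindexTransposeInv_symm ρ b⟩

/-- The trivial rescaling is the identity. [folklore] -/
theorem tp_twist_one {ι : Type*} (F : MvPolynomial ι ℂ) :
    aeval (fun e : ι => C (((1 : ℕ) : ℕ) : ℂ) * X e) F = F := by
  have h : (fun e : ι => C (((1 : ℕ) : ℕ) : ℂ) * X e) = X := by
    funext e; rw [Nat.cast_one, C_1, one_mul]
  rw [h, aeval_X_left, AlgHom.id_apply]

/-- A diagonal rescaling preserves homogeneity. [folklore] -/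
theorem tp_isHomogeneous_twist {ι : Type*} (t : ι → ℂ) {F : MvPolynomial ι ℂ} {D : ℕ}
    (hF : F.IsHomogeneous D) : (aeval (fun e : ι => C (t e) * X e) F).IsHomogeneous D := by
  have h := hF.aeval (fun e : ι => C (t e) * X e) (fun e => (isHomogeneous_X ℂ e).C_mul (t e))
  rwa [one_mul] at h

/-- `wordOfForm` as a `ℂ`-linear map (for `map_sum`). [folklore] -/
theorem tp_exists_wordOfFormLin (ρ : Fin M ≃ σ) (n d : ℕ) :
    ∃ WL : MvPolynomial (DegIdx σ n) ℂ →ₗ[ℂ] (Word M (d * n) → ℂ), ∀ F, WL F = wordOfForm ρ n d F :=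
  ⟨{ toFun := wordOfForm ρ n d
     map_add' := tp_wordOfForm_add ρ
     map_smul' := fun c F => wordOfForm_smul ρ c F }, fun _ => rfl⟩

end

end Summit.ValiantsHypothesis.ValiantsHypothesis.Theorems.ValuativeFlip
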